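import Literature.NumberTheory.EllipticCurves.IntSeriesValuesCertificate
import Literature.NumberTheory.EllipticCurves.IntSeriesFwdDiffCertificate
import HarnessLib

set_option autoImplicit false

/-!
# Reading a unit coefficient of a bounded `p`-adic power series off TWO or THREE values, with NO
# a-priori radius: the radius-free one- and two-point certificates

Topic `NumberTheory/EllipticCurves` (receptacle `𝒪_{ℂ_p}⟦T⟧` of the tree's `p`-adic `L`-functions, values
`IntSeries.HasValueAt`).  Companion of `IntSeriesValuesCertificate` (dual Vandermonde vector) and
`IntSeriesFwdDiffCertificate` (forward differences at geometric nodes `uᵗ − 1`): those certify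
`λ̄(F) = k` from `k + 1` values GIVEN the exact radius `‖u − 1‖` of the nodes.  Here the radius is NOT an
input: only an UPPER bound `‖u − 1‖ ≤ ‖ϖ‖` is assumed (for the avatar of a character with values in the
one-units of level `|p|` this is free), and the exact radius comes OUT of the values.

For `F = Σ c_j T^j ∈ 𝒪_{ℂ_p}⟦T⟧`, `‖ϖ‖ < 1`, `u ∈ ℂ_p` with `‖u − 1‖ ≤ ‖ϖ‖`:

* `isUnit_coeff_one_of_values` (one step): `‖F(0)‖ < ‖ϖ‖` and `‖F(u − 1)‖ = ‖ϖ‖` force `c₁ ∈ 𝒪^×`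
  AND `‖u − 1‖ = ‖ϖ‖` (`F(u−1) = c₀ + c₁(u−1) + O((u−1)²)`, ultrametric bookkeeping).
* `isUnit_coeff_two_of_values` (two steps, `p ≠ 2`): `‖F(0)‖ < ‖ϖ‖²`, `‖F(u − 1)‖ < ‖ϖ‖²` and
  `‖F(u² − 1)‖ = ‖ϖ‖²` force `c₂ ∈ 𝒪^×` AND `‖u − 1‖ = ‖ϖ‖` (with `W_t = c₁(uᵗ − 1) + c₂(uᵗ − 1)²`:
  `W₂ − (u + 1)·W₁ = c₂ (u − 1)² u (u + 1)`, and `‖u‖ = ‖u + 1‖ = 1` as `‖2‖ = 1`), together with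
  `c₀, c₁ ∉ 𝒪^×` (`not_isUnit_coeff_zero_of_values`, `norm_coeff_one_le_of_values`): `λ̄(F) = 2` EXACTLY.
* `isUnit_coeff_two_of_nodeValues` — the same in the node currency `t ↦ uᵗ − 1`, `t ≤ 2`, of
  `IntSeriesFwdDiffCertificate` (drop-in for its `k = 2` case: no drift, no `u ≠ 1`, no exact radius).

Written for the negative road of crux `CycTangentCM.CycTangentBound` (stmt-BirchSwinnertonDyer-22628):
the lead's kill test at the witnesses `(y² = x³ − 2, 7)`, `(27a ⊗ 17, 7)` reads `‖x₁‖ = 7⁻³ < ‖x₂‖ = 7⁻²`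
for the frame values at `ψ̄⁷, ψ̄¹³` on the split-prime line, and presupposes the exact radius
`‖u − 1‖ = 7⁻¹` of the nodes; with the two-point certificate that input disappears.  THEOREMS ONLY (no
definition, no named fact, no `sorry`); usable by any cell booking a `λ`-invariant from special values.

References: F. Gouvêa, *p-adic Numbers*, §5.6 (truncation bounds on closed discs, Strassman);
L. Washington, *Introduction to Cyclotomic Fields*, GTM 83, §5.2, §7.2 (`λ` from congruences of values).
-/

noncomputable section

open scoped Classical
open PowerSeries

namespace Literature.NumberTheory.EllipticCurves.IntSeries

variable {p : ℕ} [Fact p.Prime]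

/-! ### §0. Small ultrametric bookkeeping in `ℂ_p` -/

/-- `‖2‖ = 1` in `ℂ_p` for `p ≠ 2`. [cite: Gouvea1993PadicNumbers, §5.6] -/
theorem norm_two_eq_one (hp2 : p ≠ 2) : ‖(2 : ℂ_[p])‖ = 1 := by
  have hp : p.Prime := Fact.out
  have h2p : 2 < p := lt_of_le_of_ne hp.two_le (Ne.symm hp2)
  have h := norm_natCast_factorial_eq_one (p := p) h2p
  rw [Nat.factorial_two] at h
  exact_mod_cast h

/-- `‖u‖ = 1` when `‖u − 1‖ < 1`. [cite: Gouvea1993PadicNumbers, §5.6] -/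
theorem norm_eq_one_of_norm_sub_one_lt {u : ℂ_[p]} (hu : ‖u - 1‖ < 1) : ‖u‖ = 1 := by
  have h1 : ‖(1 : ℂ_[p])‖ = 1 := norm_one
  have hne : ‖(1 : ℂ_[p])‖ ≠ ‖u - 1‖ := by rw [h1]; exact hu.ne'
  have hu' : u = 1 + (u - 1) := by ring
  rw [hu', IsUltrametricDist.norm_add_eq_max_of_norm_ne_norm hne, h1, max_eq_left hu.le]

/-- `‖u + 1‖ = 1` when `‖u − 1‖ < 1` and `p ≠ 2` (`u + 1 = 2 + (u − 1)`).
[cite: Gouvea1993PadicNumbers, §5.6] -/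
theorem norm_add_one_eq_one (hp2 : p ≠ 2) {u : ℂ_[p]} (hu : ‖u - 1‖ < 1) : ‖u + 1‖ = 1 := by
  have h2 := norm_two_eq_one (p := p) hp2
  have hne : ‖(2 : ℂ_[p])‖ ≠ ‖u - 1‖ := by rw [h2]; exact hu.ne'
  have hu' : u + 1 = 2 + (u - 1) := by ring
  rw [hu', IsUltrametricDist.norm_add_eq_max_of_norm_ne_norm hne, h2, max_eq_left hu.le]

/-- `‖u² − 1‖ = ‖u − 1‖` when `‖u − 1‖ < 1` and `p ≠ 2`. [cite: Gouvea1993PadicNumbers, §5.6] -/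
theorem norm_sq_sub_one_eq (hp2 : p ≠ 2) {u : ℂ_[p]} (hu : ‖u - 1‖ < 1) : ‖u ^ 2 - 1‖ = ‖u - 1‖ := by
  have h : u ^ 2 - 1 = (u - 1) * (u + 1) := by ring
  rw [h, norm_mul, norm_add_one_eq_one hp2 hu, mul_one]

/-- **Degree-one truncation at a point of the closed disc `‖x‖ ≤ ‖u − 1‖ < 1`**:
`‖F(x) − (c₀ + c₁x)‖ ≤ ‖u − 1‖²`. [cite: Gouvea1993PadicNumbers, §5.6 (Cor. 5.6.3, proof)] -/
theorem norm_sub_trunc_one_le {F : PowerSeries (PadicComplexInt p)} {x v w : ℂ_[p]} (hw : ‖w‖ < 1)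
    (hx : ‖x‖ ≤ ‖w‖) (hv : IntSeries.HasValueAt F x v) :
    ‖v - (((PowerSeries.coeff 0 F : PadicComplexInt p) : ℂ_[p]) +
      ((PowerSeries.coeff 1 F : PadicComplexInt p) : ℂ_[p]) * x)‖ ≤ ‖w‖ ^ 2 := by
  have h := norm_sub_truncation_le hw hx hv 1
  have hsum : ∑ j ∈ Finset.range (1 + 1), ((PowerSeries.coeff j F : PadicComplexInt p) : ℂ_[p]) * x ^ j
      = ((PowerSeries.coeff 0 F : PadicComplexInt p) : ℂ_[p]) +
        ((PowerSeries.coeff 1 F : PadicComplexInt p) : ℂ_[p]) * x := by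
    rw [Finset.sum_range_succ, Finset.sum_range_succ, Finset.sum_range_zero]
    ring
  rwa [hsum] at h

/-- **Degree-two truncation at a point of the closed disc `‖x‖ ≤ ‖u − 1‖ < 1`**:
`‖F(x) − (c₀ + c₁x + c₂x²)‖ ≤ ‖u − 1‖³`. [cite: Gouvea1993PadicNumbers, §5.6 (Cor. 5.6.3, proof)] -/
theorem norm_sub_trunc_two_le {F : PowerSeries (PadicComplexInt p)} {x v w : ℂ_[p]} (hw : ‖w‖ < 1)
    (hx : ‖x‖ ≤ ‖w‖) (hv : IntSeries.HasValueAt F x v) :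
    ‖v - (((PowerSeries.coeff 0 F : PadicComplexInt p) : ℂ_[p]) +
      ((PowerSeries.coeff 1 F : PadicComplexInt p) : ℂ_[p]) * x +
      ((PowerSeries.coeff 2 F : PadicComplexInt p) : ℂ_[p]) * x ^ 2)‖ ≤ ‖w‖ ^ 3 := by
  have h := norm_sub_truncation_le hw hx hv 2
  have hsum : ∑ j ∈ Finset.range (2 + 1), ((PowerSeries.coeff j F : PadicComplexInt p) : ℂ_[p]) * x ^ j
      = ((PowerSeries.coeff 0 F : PadicComplexInt p) : ℂ_[p]) +
        ((PowerSeries.coeff 1 F : PadicComplexInt p) : ℂ_[p]) * x +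
        ((PowerSeries.coeff 2 F : PadicComplexInt p) : ℂ_[p]) * x ^ 2 := by
    rw [Finset.sum_range_succ, Finset.sum_range_succ, Finset.sum_range_succ, Finset.sum_range_zero]
    ring
  rwa [hsum] at h

/-! ### §1. One step: `c₁ ∈ 𝒪^×` and the radius from two values -/

/-- **Radius-free one-point certificate.**  For `F ∈ 𝒪_{ℂ_p}⟦T⟧`, `‖ϖ‖ < 1` and `‖u − 1‖ ≤ ‖ϖ‖`: if
`‖F(0)‖ < ‖ϖ‖` and `‖F(u − 1)‖ = ‖ϖ‖` then `[T¹]F` is a unit AND `‖u − 1‖ = ‖ϖ‖`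
(`F(u−1) = c₀ + c₁(u−1) + O(‖u−1‖²)`, so `‖c₁‖·‖u−1‖ = ‖ϖ‖` with `‖c₁‖ ≤ 1`, `‖u−1‖ ≤ ‖ϖ‖`).
[cite: Washington1997, §5.2 (Thm. 5.11, proof); Gouvea1993PadicNumbers, §5.6] -/
theorem isUnit_coeff_one_of_values (F : PowerSeries (PadicComplexInt p)) {u ϖ v₀ v₁ : ℂ_[p]}
    (hϖ : ‖ϖ‖ < 1) (hu : ‖u - 1‖ ≤ ‖ϖ‖) (h0 : IntSeries.HasValueAt F 0 v₀)
    (h1 : IntSeries.HasValueAt F (u - 1) v₁) (hv₀ : ‖v₀‖ < ‖ϖ‖) (hv₁ : ‖v₁‖ = ‖ϖ‖) :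
    IsUnit (PowerSeries.coeff 1 F) ∧ ‖u - 1‖ = ‖ϖ‖ := by
  set c₀ : ℂ_[p] := ((PowerSeries.coeff 0 F : PadicComplexInt p) : ℂ_[p]) with hc₀
  set c₁ : ℂ_[p] := ((PowerSeries.coeff 1 F : PadicComplexInt p) : ℂ_[p]) with hc₁
  have hρ0 : 0 < ‖ϖ‖ := lt_of_le_of_lt (norm_nonneg _) hv₀
  have hr1 : ‖u - 1‖ < 1 := lt_of_le_of_lt hu hϖ
  -- `v₀ = c₀`
  have hv₀c : v₀ = c₀ := by
    rw [hc₀, PowerSeries.coeff_zero_eq_constantCoeff_apply]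
    exact IntSeries.eq_constantCoeff_of_hasValueAt_zero h0
  have hc₀n : ‖c₀‖ < ‖ϖ‖ := hv₀c ▸ hv₀
  -- truncation: `v₁ = c₀ + c₁ (u - 1) + e`, `‖e‖ ≤ ‖u - 1‖² ≤ ‖ϖ‖² < ‖ϖ‖`
  have he : ‖v₁ - (c₀ + c₁ * (u - 1))‖ ≤ ‖u - 1‖ ^ 2 := norm_sub_trunc_one_le hr1 le_rfl h1
  have he' : ‖v₁ - (c₀ + c₁ * (u - 1))‖ < ‖ϖ‖ := by
    refine lt_of_le_of_lt (he.trans (pow_le_pow_left₀ (norm_nonneg _) hu 2)) ?_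
    calc ‖ϖ‖ ^ 2 = ‖ϖ‖ * ‖ϖ‖ := sq _
      _ < 1 * ‖ϖ‖ := mul_lt_mul_of_pos_right hϖ hρ0
      _ = ‖ϖ‖ := one_mul _
  -- hence `‖c₁ (u - 1)‖ = ‖ϖ‖`
  have hmain : ‖c₁ * (u - 1)‖ = ‖ϖ‖ := by
    have hdecomp : c₁ * (u - 1) = v₁ - ((v₁ - (c₀ + c₁ * (u - 1))) + c₀) := by ring
    have hsmall : ‖(v₁ - (c₀ + c₁ * (u - 1))) + c₀‖ < ‖ϖ‖ :=
      lt_of_le_of_lt (IsUltrametricDist.norm_add_le_max _ _) (max_lt he' hc₀n)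
    have hne : ‖v₁‖ ≠ ‖-((v₁ - (c₀ + c₁ * (u - 1))) + c₀)‖ := by
      rw [norm_neg, hv₁]; exact hsmall.ne'
    rw [hdecomp, sub_eq_add_neg, IsUltrametricDist.norm_add_eq_max_of_norm_ne_norm hne, norm_neg, hv₁,
      max_eq_left hsmall.le]
  rw [norm_mul] at hmain
  have hc₁le : ‖c₁‖ ≤ 1 := norm_coe_padicComplexInt_le_one _
  -- `‖c₁‖ ‖u-1‖ = ‖ϖ‖`, `‖c₁‖ ≤ 1`, `‖u - 1‖ ≤ ‖ϖ‖` ⟹ both equalities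
  have hr : ‖u - 1‖ = ‖ϖ‖ := by
    refine le_antisymm hu ?_
    calc ‖ϖ‖ = ‖c₁‖ * ‖u - 1‖ := hmain.symm
      _ ≤ 1 * ‖u - 1‖ := mul_le_mul_of_nonneg_right hc₁le (norm_nonneg _)
      _ = ‖u - 1‖ := one_mul _
  refine ⟨?_, hr⟩
  rw [isUnit_padicComplexInt_iff, ← hc₁]
  rw [hr] at hmain
  have := mul_right_cancel₀ hρ0.ne' (hmain.trans (one_mul ‖ϖ‖).symm)
  exact this

/-! ### §2. Two steps: `c₂ ∈ 𝒪^×` and the radius from three values (`p ≠ 2`) -/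

/-- **Radius-free two-point certificate.**  For `F ∈ 𝒪_{ℂ_p}⟦T⟧`, `p ≠ 2`, `‖ϖ‖ < 1` and
`‖u − 1‖ ≤ ‖ϖ‖`: if `‖F(0)‖ < ‖ϖ‖²`, `‖F(u − 1)‖ < ‖ϖ‖²` and `‖F(u² − 1)‖ = ‖ϖ‖²` then `[T²]F` is a
unit AND `‖u − 1‖ = ‖ϖ‖`.  (With `W_t := c₁(uᵗ−1) + c₂(uᵗ−1)² = F(uᵗ−1) − c₀ − O(‖u−1‖³)`:
`‖W₁‖ < ‖ϖ‖²`, `‖W₂‖ = ‖ϖ‖²`, and `W₂ − (u+1)W₁ = c₂(u−1)²u(u+1)` has norm `‖c₂‖‖u−1‖²`; so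
`‖ϖ‖² = ‖c₂‖‖u−1‖² ≤ ‖u−1‖² ≤ ‖ϖ‖²`.)  No drift, no `u ≠ 1`, no exact radius among the hypotheses.
[cite: Washington1997, §5.2 (Thm. 5.11, proof); Gouvea1993PadicNumbers, §5.6] -/
theorem isUnit_coeff_two_of_values (hp2 : p ≠ 2) (F : PowerSeries (PadicComplexInt p))
    {u ϖ v₀ v₁ v₂ : ℂ_[p]} (hϖ : ‖ϖ‖ < 1) (hu : ‖u - 1‖ ≤ ‖ϖ‖) (h0 : IntSeries.HasValueAt F 0 v₀)
    (h1 : IntSeries.HasValueAt F (u - 1) v₁) (h2 : IntSeries.HasValueAt F (u ^ 2 - 1) v₂)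
    (hv₀ : ‖v₀‖ < ‖ϖ‖ ^ 2) (hv₁ : ‖v₁‖ < ‖ϖ‖ ^ 2) (hv₂ : ‖v₂‖ = ‖ϖ‖ ^ 2) :
    IsUnit (PowerSeries.coeff 2 F) ∧ ‖u - 1‖ = ‖ϖ‖ := by
  set c₀ : ℂ_[p] := ((PowerSeries.coeff 0 F : PadicComplexInt p) : ℂ_[p]) with hc₀
  set c₁ : ℂ_[p] := ((PowerSeries.coeff 1 F : PadicComplexInt p) : ℂ_[p]) with hc₁
  set c₂ : ℂ_[p] := ((PowerSeries.coeff 2 F : PadicComplexInt p) : ℂ_[p]) with hc₂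
  have hρ2pos : 0 < ‖ϖ‖ ^ 2 := lt_of_le_of_lt (norm_nonneg _) hv₀
  have hρ0 : 0 < ‖ϖ‖ := by
    rcases (norm_nonneg ϖ).eq_or_lt with h | h
    · rw [← h] at hρ2pos; simp at hρ2pos
    · exact h
  have hr1 : ‖u - 1‖ < 1 := lt_of_le_of_lt hu hϖ
  have hρ32 : ‖ϖ‖ ^ 3 < ‖ϖ‖ ^ 2 := by
    calc ‖ϖ‖ ^ 3 = ‖ϖ‖ * ‖ϖ‖ ^ 2 := by ring
      _ < 1 * ‖ϖ‖ ^ 2 := mul_lt_mul_of_pos_right hϖ hρ2pos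
      _ = ‖ϖ‖ ^ 2 := one_mul _
  -- `v₀ = c₀`
  have hv₀c : v₀ = c₀ := by
    rw [hc₀, PowerSeries.coeff_zero_eq_constantCoeff_apply]
    exact IntSeries.eq_constantCoeff_of_hasValueAt_zero h0
  have hc₀n : ‖c₀‖ < ‖ϖ‖ ^ 2 := hv₀c ▸ hv₀
  -- norms of the nodes
  have hx1 : ‖u - 1‖ ≤ ‖u - 1‖ := le_rfl
  have hx2 : ‖u ^ 2 - 1‖ ≤ ‖u - 1‖ := (norm_sq_sub_one_eq hp2 hr1).le
  -- truncations
  have he₁ : ‖v₁ - (c₀ + c₁ * (u - 1) + c₂ * (u - 1) ^ 2)‖ ≤ ‖u - 1‖ ^ 3 :=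
    norm_sub_trunc_two_le hr1 hx1 h1
  have he₂ : ‖v₂ - (c₀ + c₁ * (u ^ 2 - 1) + c₂ * (u ^ 2 - 1) ^ 2)‖ ≤ ‖u - 1‖ ^ 3 :=
    norm_sub_trunc_two_le hr1 hx2 h2
  have hr3 : ‖u - 1‖ ^ 3 ≤ ‖ϖ‖ ^ 3 := pow_le_pow_left₀ (norm_nonneg _) hu 3
  set e₁ : ℂ_[p] := v₁ - (c₀ + c₁ * (u - 1) + c₂ * (u - 1) ^ 2) with he₁_def
  set e₂ : ℂ_[p] := v₂ - (c₀ + c₁ * (u ^ 2 - 1) + c₂ * (u ^ 2 - 1) ^ 2) with he₂_def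
  have he₁' : ‖e₁‖ < ‖ϖ‖ ^ 2 := lt_of_le_of_lt (he₁.trans hr3) hρ32
  have he₂' : ‖e₂‖ < ‖ϖ‖ ^ 2 := lt_of_le_of_lt (he₂.trans hr3) hρ32
  -- the principal parts `W_t = c₁ (u^t - 1) + c₂ (u^t - 1)^2`
  set W₁ : ℂ_[p] := c₁ * (u - 1) + c₂ * (u - 1) ^ 2 with hW₁
  set W₂ : ℂ_[p] := c₁ * (u ^ 2 - 1) + c₂ * (u ^ 2 - 1) ^ 2 with hW₂
  have hW₁eq : W₁ = v₁ - (e₁ + c₀) := by rw [he₁_def]; ring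
  have hW₂eq : W₂ = v₂ - (e₂ + c₀) := by rw [he₂_def]; ring
  have hs₁ : ‖e₁ + c₀‖ < ‖ϖ‖ ^ 2 :=
    lt_of_le_of_lt (IsUltrametricDist.norm_add_le_max _ _) (max_lt he₁' hc₀n)
  have hs₂ : ‖e₂ + c₀‖ < ‖ϖ‖ ^ 2 :=
    lt_of_le_of_lt (IsUltrametricDist.norm_add_le_max _ _) (max_lt he₂' hc₀n)
  have hW₁n : ‖W₁‖ < ‖ϖ‖ ^ 2 := by
    rw [hW₁eq, sub_eq_add_neg]
    refine lt_of_le_of_lt (IsUltrametricDist.norm_add_le_max _ _) (max_lt hv₁ ?_)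
    rwa [norm_neg]
  have hW₂n : ‖W₂‖ = ‖ϖ‖ ^ 2 := by
    have hne : ‖v₂‖ ≠ ‖-(e₂ + c₀)‖ := by rw [norm_neg, hv₂]; exact hs₂.ne'
    rw [hW₂eq, sub_eq_add_neg, IsUltrametricDist.norm_add_eq_max_of_norm_ne_norm hne, norm_neg, hv₂,
      max_eq_left hs₂.le]
  -- the key identity
  have hkey : W₂ - (u + 1) * W₁ = c₂ * (u - 1) ^ 2 * (u * (u + 1)) := by
    rw [hW₁, hW₂]; ring
  have hu1 : ‖u + 1‖ = 1 := norm_add_one_eq_one hp2 hr1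
  have hu0 : ‖u‖ = 1 := norm_eq_one_of_norm_sub_one_lt hr1
  have hlhs : ‖W₂ - (u + 1) * W₁‖ = ‖ϖ‖ ^ 2 := by
    have hsm : ‖(u + 1) * W₁‖ < ‖ϖ‖ ^ 2 := by rw [norm_mul, hu1, one_mul]; exact hW₁n
    have hne : ‖W₂‖ ≠ ‖-((u + 1) * W₁)‖ := by rw [norm_neg, hW₂n]; exact hsm.ne'
    rw [sub_eq_add_neg, IsUltrametricDist.norm_add_eq_max_of_norm_ne_norm hne, norm_neg, hW₂n,
      max_eq_left hsm.le]
  have hrhs : ‖c₂ * (u - 1) ^ 2 * (u * (u + 1))‖ = ‖c₂‖ * ‖u - 1‖ ^ 2 := by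
    rw [norm_mul, norm_mul, norm_mul, norm_pow, hu0, hu1, mul_one, mul_one]
  have hmain : ‖c₂‖ * ‖u - 1‖ ^ 2 = ‖ϖ‖ ^ 2 := by rw [← hrhs, ← hkey, hlhs]
  have hc₂le : ‖c₂‖ ≤ 1 := norm_coe_padicComplexInt_le_one _
  have hr2le : ‖u - 1‖ ^ 2 ≤ ‖ϖ‖ ^ 2 := pow_le_pow_left₀ (norm_nonneg _) hu 2
  -- squeeze: `‖ϖ‖² = ‖c₂‖‖u-1‖² ≤ ‖u-1‖² ≤ ‖ϖ‖²`
  have hr2 : ‖u - 1‖ ^ 2 = ‖ϖ‖ ^ 2 := by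
    refine le_antisymm hr2le ?_
    calc ‖ϖ‖ ^ 2 = ‖c₂‖ * ‖u - 1‖ ^ 2 := hmain.symm
      _ ≤ 1 * ‖u - 1‖ ^ 2 := mul_le_mul_of_nonneg_right hc₂le (pow_nonneg (norm_nonneg _) _)
      _ = ‖u - 1‖ ^ 2 := one_mul _
  have hr : ‖u - 1‖ = ‖ϖ‖ := by
    have h := (sq_eq_sq₀ (norm_nonneg (u - 1)) (norm_nonneg ϖ)).mp hr2
    exact h
  refine ⟨?_, hr⟩
  rw [isUnit_padicComplexInt_iff, ← hc₂]
  rw [hr2] at hmain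
  exact mul_right_cancel₀ hρ2pos.ne' (hmain.trans (one_mul (‖ϖ‖ ^ 2)).symm)

/-- Under the hypotheses of `isUnit_coeff_two_of_values`, the constant term is NOT a unit
(`‖c₀‖ = ‖F(0)‖ < ‖ϖ‖² < 1`). [cite: Washington1997, §5.2] -/
theorem not_isUnit_coeff_zero_of_values (F : PowerSeries (PadicComplexInt p)) {ϖ v₀ : ℂ_[p]}
    (hϖ : ‖ϖ‖ < 1) (h0 : IntSeries.HasValueAt F 0 v₀) (hv₀ : ‖v₀‖ < ‖ϖ‖ ^ 2) :
    ¬ IsUnit (PowerSeries.coeff 0 F) := by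
  have hv₀c : v₀ = ((PowerSeries.coeff 0 F : PadicComplexInt p) : ℂ_[p]) := by
    rw [PowerSeries.coeff_zero_eq_constantCoeff_apply]
    exact IntSeries.eq_constantCoeff_of_hasValueAt_zero h0
  rw [isUnit_padicComplexInt_iff, ← hv₀c]
  have h1 : ‖ϖ‖ ^ 2 ≤ 1 := pow_le_one₀ (norm_nonneg _) hϖ.le
  exact (lt_of_lt_of_le hv₀ h1).ne

/-- Under the hypotheses of `isUnit_coeff_two_of_values`, the linear coefficient is small:
`‖c₁‖ ≤ ‖ϖ‖` (from `‖W₁‖ < ‖ϖ‖²` and `‖u − 1‖ = ‖ϖ‖`); in particular `c₁ ∉ 𝒪^×`, so `λ̄(F) = 2`.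
[cite: Washington1997, §5.2 (Thm. 5.11, proof)] -/
theorem norm_coeff_one_le_of_values (hp2 : p ≠ 2) (F : PowerSeries (PadicComplexInt p))
    {u ϖ v₀ v₁ v₂ : ℂ_[p]} (hϖ : ‖ϖ‖ < 1) (hu : ‖u - 1‖ ≤ ‖ϖ‖) (h0 : IntSeries.HasValueAt F 0 v₀)
    (h1 : IntSeries.HasValueAt F (u - 1) v₁) (h2 : IntSeries.HasValueAt F (u ^ 2 - 1) v₂)
    (hv₀ : ‖v₀‖ < ‖ϖ‖ ^ 2) (hv₁ : ‖v₁‖ < ‖ϖ‖ ^ 2) (hv₂ : ‖v₂‖ = ‖ϖ‖ ^ 2) :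
    ‖((PowerSeries.coeff 1 F : PadicComplexInt p) : ℂ_[p])‖ ≤ ‖ϖ‖ ∧
      ¬ IsUnit (PowerSeries.coeff 1 F) := by
  have hr : ‖u - 1‖ = ‖ϖ‖ := (isUnit_coeff_two_of_values hp2 F hϖ hu h0 h1 h2 hv₀ hv₁ hv₂).2
  set c₀ : ℂ_[p] := ((PowerSeries.coeff 0 F : PadicComplexInt p) : ℂ_[p]) with hc₀
  set c₁ : ℂ_[p] := ((PowerSeries.coeff 1 F : PadicComplexInt p) : ℂ_[p]) with hc₁
  set c₂ : ℂ_[p] := ((PowerSeries.coeff 2 F : PadicComplexInt p) : ℂ_[p]) with hc₂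
  have hρ2pos : 0 < ‖ϖ‖ ^ 2 := lt_of_le_of_lt (norm_nonneg _) hv₀
  have hρ0 : 0 < ‖ϖ‖ := by
    rcases (norm_nonneg ϖ).eq_or_lt with h | h
    · rw [← h] at hρ2pos; simp at hρ2pos
    · exact h
  have hr1 : ‖u - 1‖ < 1 := lt_of_le_of_lt hu hϖ
  have hv₀c : v₀ = c₀ := by
    rw [hc₀, PowerSeries.coeff_zero_eq_constantCoeff_apply]
    exact IntSeries.eq_constantCoeff_of_hasValueAt_zero h0
  have hc₀n : ‖c₀‖ < ‖ϖ‖ ^ 2 := hv₀c ▸ hv₀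
  have he₁ : ‖v₁ - (c₀ + c₁ * (u - 1) + c₂ * (u - 1) ^ 2)‖ ≤ ‖u - 1‖ ^ 3 :=
    norm_sub_trunc_two_le hr1 le_rfl h1
  have hρ32 : ‖ϖ‖ ^ 3 < ‖ϖ‖ ^ 2 := by
    calc ‖ϖ‖ ^ 3 = ‖ϖ‖ * ‖ϖ‖ ^ 2 := by ring
      _ < 1 * ‖ϖ‖ ^ 2 := mul_lt_mul_of_pos_right hϖ hρ2pos
      _ = ‖ϖ‖ ^ 2 := one_mul _
  have he₁' : ‖v₁ - (c₀ + c₁ * (u - 1) + c₂ * (u - 1) ^ 2)‖ < ‖ϖ‖ ^ 2 :=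
    lt_of_le_of_lt (he₁.trans (pow_le_pow_left₀ (norm_nonneg _) hu 3)) hρ32
  -- `‖W₁‖ < ‖ϖ‖²` with `W₁ = (u-1)(c₁ + c₂(u-1))`
  have hW₁n : ‖(u - 1) * (c₁ + c₂ * (u - 1))‖ < ‖ϖ‖ ^ 2 := by
    have hdecomp : (u - 1) * (c₁ + c₂ * (u - 1)) =
        v₁ + -((v₁ - (c₀ + c₁ * (u - 1) + c₂ * (u - 1) ^ 2)) + c₀) := by ring
    rw [hdecomp]
    refine lt_of_le_of_lt (IsUltrametricDist.norm_add_le_max _ _) (max_lt hv₁ ?_)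
    rw [norm_neg]
    exact lt_of_le_of_lt (IsUltrametricDist.norm_add_le_max _ _) (max_lt he₁' hc₀n)
  rw [norm_mul, hr, sq] at hW₁n
  have hq : ‖c₁ + c₂ * (u - 1)‖ < ‖ϖ‖ := lt_of_mul_lt_mul_left hW₁n (norm_nonneg _)
  have hc₂u : ‖c₂ * (u - 1)‖ ≤ ‖ϖ‖ := by
    rw [norm_mul, hr]
    calc ‖c₂‖ * ‖ϖ‖ ≤ 1 * ‖ϖ‖ := mul_le_mul_of_nonneg_right (norm_coe_padicComplexInt_le_one _)
          (norm_nonneg _)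
      _ = ‖ϖ‖ := one_mul _
  have hc₁le : ‖c₁‖ ≤ ‖ϖ‖ := by
    have hdecomp : c₁ = (c₁ + c₂ * (u - 1)) + -(c₂ * (u - 1)) := by ring
    rw [hdecomp]
    refine (IsUltrametricDist.norm_add_le_max _ _).trans (max_le hq.le ?_)
    rwa [norm_neg]
  refine ⟨hc₁le, ?_⟩
  rw [isUnit_padicComplexInt_iff, ← hc₁]
  exact (lt_of_le_of_lt hc₁le hϖ).ne

/-! ### §3. Node currency `t ↦ uᵗ − 1` (drop-in for the `k = 2` forward-difference certificate) -/

/-- **Radius-free two-point certificate, node form.**  Values `v t = F(uᵗ − 1)` for `t ≤ 2`,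
`p ≠ 2`, `‖ϖ‖ < 1`, `‖u − 1‖ ≤ ‖ϖ‖`, `‖v 0‖ < ‖ϖ‖²`, `‖v 1‖ < ‖ϖ‖²`, `‖v 2‖ = ‖ϖ‖²` ⟹ `[T²]F ∈ 𝒪^×`
and `‖u − 1‖ = ‖ϖ‖` — the `k = 2` case of `IntSeriesFwdDiffCertificate` with no drift, no `u ≠ 1` and
no exact radius among the hypotheses. [cite: Washington1997, §5.2 (Thm. 5.11, proof)] -/
theorem isUnit_coeff_two_of_nodeValues (hp2 : p ≠ 2) (F : PowerSeries (PadicComplexInt p))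
    {u ϖ : ℂ_[p]} (hϖ : ‖ϖ‖ < 1) (hu : ‖u - 1‖ ≤ ‖ϖ‖) {v : ℕ → ℂ_[p]}
    (hv : ∀ t, t ≤ 2 → IntSeries.HasValueAt F (u ^ t - 1) (v t))
    (hv₀ : ‖v 0‖ < ‖ϖ‖ ^ 2) (hv₁ : ‖v 1‖ < ‖ϖ‖ ^ 2) (hv₂ : ‖v 2‖ = ‖ϖ‖ ^ 2) :
    IsUnit (PowerSeries.coeff 2 F) ∧ ‖u - 1‖ = ‖ϖ‖ := by
  have h0 : IntSeries.HasValueAt F 0 (v 0) := by simpa using hv 0 (by norm_num)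
  have h1 : IntSeries.HasValueAt F (u - 1) (v 1) := by simpa using hv 1 (by norm_num)
  have h2 : IntSeries.HasValueAt F (u ^ 2 - 1) (v 2) := hv 2 le_rfl
  exact isUnit_coeff_two_of_values hp2 F hϖ hu h0 h1 h2 hv₀ hv₁ hv₂

/-- **Radius-free one-point certificate, node form** (`k = 1`): `‖v 0‖ < ‖ϖ‖`, `‖v 1‖ = ‖ϖ‖` ⟹
`[T¹]F ∈ 𝒪^×` and `‖u − 1‖ = ‖ϖ‖`. [cite: Washington1997, §5.2 (Thm. 5.11, proof)] -/
theorem isUnit_coeff_one_of_nodeValues (F : PowerSeries (PadicComplexInt p)) {u ϖ : ℂ_[p]}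
    (hϖ : ‖ϖ‖ < 1) (hu : ‖u - 1‖ ≤ ‖ϖ‖) {v : ℕ → ℂ_[p]}
    (hv : ∀ t, t ≤ 1 → IntSeries.HasValueAt F (u ^ t - 1) (v t))
    (hv₀ : ‖v 0‖ < ‖ϖ‖) (hv₁ : ‖v 1‖ = ‖ϖ‖) :
    IsUnit (PowerSeries.coeff 1 F) ∧ ‖u - 1‖ = ‖ϖ‖ := by
  have h0 : IntSeries.HasValueAt F 0 (v 0) := by simpa using hv 0 (by norm_num)
  have h1 : IntSeries.HasValueAt F (u - 1) (v 1) := by simpa using hv 1 le_rfl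
  exact isUnit_coeff_one_of_values F hϖ hu h0 h1 hv₀ hv₁

/-! ### §4. From the three norms to the forward-difference certificate at EVERY node base -/

/-- **The three norms at ONE node base give the `k = 2`, `η = 1` forward-difference certificate at EVERY
node base of the same branch.**  Under the hypotheses of `isUnit_coeff_two_of_values` (`p ≠ 2`, `‖ϖ‖ < 1`,
`‖u − 1‖ ≤ ‖ϖ‖`, `‖F(0)‖ < ‖ϖ‖²`, `‖F(u − 1)‖ < ‖ϖ‖²`, `‖F(u² − 1)‖ = ‖ϖ‖²`) the branch has `λ̄(F) = 2`
exactly (`c₀, c₁ ∉ 𝒪ˣ`, `c₂ ∈ 𝒪ˣ`), so for ANY `u'` with `u' ≠ 1`, `‖u' − 1‖ < 1` and values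
`y_t = F(u'ᵗ − 1)` (`t ≤ 2`): `‖y₀‖ < 1`, `‖y₁ − y₀‖ < ‖u' − 1‖` and `‖y₂ − 2y₁ + y₀‖ = ‖u' − 1‖²` (in the
literal `fwdDiffWeight` shape of `IntSeriesFwdDiffCertificate`, drift `η = 1`) — the radius of the new
nodes is arbitrary.  (Use: a numerical certificate computed at one node radius is valid, for the same
branch, at the node radius of every admissible power-line datum.)
[cite: Washington1997, §5.2 (Thm. 5.11, proof)] -/
theorem fwdDiffCertificate_two_of_values (hp2 : p ≠ 2) (F : PowerSeries (PadicComplexInt p))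
    {u ϖ v₀ v₁ v₂ : ℂ_[p]} (hϖ : ‖ϖ‖ < 1) (hu : ‖u - 1‖ ≤ ‖ϖ‖) (h0 : IntSeries.HasValueAt F 0 v₀)
    (h1 : IntSeries.HasValueAt F (u - 1) v₁) (h2 : IntSeries.HasValueAt F (u ^ 2 - 1) v₂)
    (hv₀ : ‖v₀‖ < ‖ϖ‖ ^ 2) (hv₁ : ‖v₁‖ < ‖ϖ‖ ^ 2) (hv₂ : ‖v₂‖ = ‖ϖ‖ ^ 2)
    {u' : ℂ_[p]} (hu'0 : u' - 1 ≠ 0) (hu'1 : ‖u' - 1‖ < 1) {y : ℕ → ℂ_[p]}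
    (hy : ∀ t, t ≤ 2 → IntSeries.HasValueAt F (u' ^ t - 1) (y t)) :
    (∀ j, j < 2 →
      ‖∑ t ∈ Finset.range (j + 1), fwdDiffWeight p j t * ((1 : ℂ_[p]) ^ t * y t)‖ < ‖u' - 1‖ ^ j) ∧
    ‖∑ t ∈ Finset.range (2 + 1), fwdDiffWeight p 2 t * ((1 : ℂ_[p]) ^ t * y t)‖ = ‖u' - 1‖ ^ 2 := by
  have hp : p.Prime := Fact.out
  have h2p : 2 < p := lt_of_le_of_ne hp.two_le (Ne.symm hp2)
  -- `λ̄(F) = 2` from the three norms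
  have hc₂ : IsUnit (PowerSeries.coeff 2 F) := (isUnit_coeff_two_of_values hp2 F hϖ hu h0 h1 h2 hv₀ hv₁ hv₂).1
  have hc₁ : ¬ IsUnit (PowerSeries.coeff 1 F) :=
    (norm_coeff_one_le_of_values hp2 F hϖ hu h0 h1 h2 hv₀ hv₁ hv₂).2
  have hc₀ : ¬ IsUnit (PowerSeries.coeff 0 F) := not_isUnit_coeff_zero_of_values F hϖ h0 hv₀
  have hη : ‖(1 : ℂ_[p]) - 1‖ ≤ ‖u' - 1‖ := by rw [sub_self, norm_zero]; exact norm_nonneg _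
  have hlow : ∀ j, j < 2 → ¬ IsUnit (PowerSeries.coeff j F) := by
    intro j hj
    interval_cases j
    · exact hc₀
    · exact hc₁
  refine ⟨fun j hj ↦ ?_, ?_⟩
  · have hjp : j < p := lt_trans hj h2p
    have hlowj : ∀ i, i < j → ¬ IsUnit (PowerSeries.coeff i F) := fun i hi ↦ hlow i (hi.trans hj)
    have hyj : ∀ t, t ≤ j → IntSeries.HasValueAt F (u' ^ t - 1) (y t) := fun t ht ↦ hy t (by omega)
    exact (not_isUnit_coeff_iff_norm_fwdDiff_values_lt F hu'0 hu'1 hη hjp hlowj hyj).mp (hlow j hj)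
  · exact (isUnit_coeff_iff_norm_fwdDiff_values_eq F hu'0 hu'1 hη h2p hlow hy).mp hc₂

end Literature.NumberTheory.EllipticCurves.IntSeries
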